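import Literature.MathematicalPhysics.QuantumLattice.FockRelabel
import Literature.MathematicalPhysics.QuantumLattice.HubbardOneBodyDensityMatrix
import HarnessLib

/-!
# Lattice-symmetry covariance of the unique half-filled Hubbard ground state

Topic `Literature/MathematicalPhysics/QuantumLattice`. Vocabulary: `HubbardWave0` (`Fock`,
`annihilation`, `creation`, `numberOp`, `expect`, `IsNParticle`, `IsGroundState`, `Orb`, `orb`),
`HubbardModel` (`hamiltonian G t U`, `FermionTorus`, `fermionTorusGraph`, `hubbardTorus`),
`FermionRelabelling` (`relabel`, `Orb.mapEquiv`, `Orb.spinSwap`), `FockRelabel` (`fockRelabel π`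
= the second-quantised unitary `U_π` of an orbital permutation, `Orb.translate`, `Orb.d4Perm`,
`fockTranslate`, `fockD4`), `HubbardHalfFilledGroundState[Torus]` (Lieb's theorem:
`LiebHalfFilled.groundState_unique`, `LiebHalfFilled.hubbardTorus_lieb_hypotheses`).

## The statement

Let `G` be a finite connected bipartite graph with colour classes of equal size, `t ≠ 0`, `U > 0`,
and let `ψ` be THE ground state of the Hubbard Hamiltonian `hamiltonian G t U` in the half-filled
sector `N = |Λ|` (unique up to a phase by Lieb's theorem, PRL 62 (1989) 1201, Theorem 2). Let `π`
be any permutation of the spin-orbitals whose second quantisation `U_π` commutes with `H`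
(`relabel π H = H`): a graph automorphism acting on sites, the exchange of the two spin values,
a torus translation, an element of the point group `D₄` of the square torus. Then

* `U_π ψ` is again a half-filled ground state (`IsGroundState.fockRelabel_mulVec` — the one-line
  argument of Lieb–Loss–McCann, J. Math. Phys. 34 (1993) 891, p. 894: "it is also a ground state;
  by uniqueness …"), hence **`U_π ψ = c ψ` with `|c| = 1`**
  (`exists_fockRelabel_mulVec_eq_smul_of_groundState`): the ground state transforms under a
  one-dimensional representation of the symmetry group of `H`;
* consequently **every expectation value is invariant**: `⟨ψ, (U_π A U_πᴴ) ψ⟩ = ⟨ψ, A ψ⟩` for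
  every operator `A` (`expect_relabel_eq_of_groundState`), whatever the character `c` is.

Specialisations recorded here (all for THE half-filled ground state):
graph automorphisms `g` (`expect_relabel_mapEquiv_eq_of_groundState`; the one-body density matrix
and the density–density correlators are `g`-invariant:
`⟨c†_{g x,σ} c_{g y,τ}⟩ = ⟨c†_{xσ} c_{yτ}⟩`, `⟨n_{g x,σ} n_{g y,τ}⟩ = ⟨n_{xσ} n_{yτ}⟩`); spin
exchange (`⟨c†_{x,1-σ} c_{y,1-τ}⟩ = ⟨c†_{xσ} c_{yτ}⟩`, in particular `G_↓ = G_↑`); and on the even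
square torus `(ℤ/Lℤ)²`: translations (`⟨c†_{x+v,σ} c_{y+v,τ}⟩ = ⟨c†_{xσ} c_{yτ}⟩`,
`⟨n_{x+v,σ} n_{y+v,τ}⟩ = ⟨n_{xσ} n_{yτ}⟩` — correlation functions depend on the displacement only),
the point group `D₄`, and the headline corollary used by benchmark tables:
**all nearest-neighbour hopping amplitudes are equal** — `⟨c†_{xσ} c_{yσ}⟩` takes one and the
same (real) value on every ordered nearest-neighbour pair `(x, y)` and both spins
(`hubbardTorus_expect_creation_mul_annihilation_nn_eq`), so that the kinetic energy is
`⟨H(t,0)⟩ = -t · 8L² · ⟨c†_{xσ} c_{yσ}⟩_{nn}` once every site has four neighbours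
(`hubbardTorus_expect_hamiltonian_zero_eq_nn`, `L ≥ 3`).

Everything is PROVED (no named facts). The file is the symmetry half of what exact-diagonalisation
and QMC benchmark papers use implicitly when they tabulate "the" nearest-neighbour hopping, the
momentum distribution `n(k) = Σ_r e^{ik·r} ⟨c†_{0σ} c_{rσ}⟩` or equal-time correlation functions
"as a function of distance" for the half-filled square-lattice Hubbard model.

## Mathlib / tree search

Tree: the operator-level machinery is `FermionRelabelling` (`relabel`, `relabel_hamiltonian`,
`relabel_spinSwap_hamiltonianWith`, `fermionTorusGraph_adj_addRight`) and `FockRelabel`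
(`fockRelabel`, `expect_relabel_fockRelabel_mulVec`, `star_fockRelabel_mulVec_dotProduct`,
`IsNParticle.fockRelabel_mulVec`, `IsGroundStateInSector.fockRelabel_mapEquiv_mulVec` — the
SECTOR version of §1 for an arbitrary invariant `H`, without uniqueness; `relabel_translate_hubbardTorus`,
`relabel_d4Perm_hubbardTorus`); uniqueness is `LiebHalfFilled.groundState_unique`.
`lean search --decl 'IsGroundState.fockRelabel|expect_relabel_eq|fockRelabel_mulVec_eq_smul'` found no
covariance statement for a VECTOR ground state (`IsGroundState`) of the Hubbard model (2026-08-20); the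
Summits-side `groundStateFunctional_conj_of_commute` / `groundStateFunctional_relabel_translate`
(`AbsenceCertificateOnePointSoundness`) concern the TRACIAL ground-state functional `Tr(P₀ ·)/Tr P₀` of the
d-wave-sourced Hamiltonian, which is symmetry-invariant without any uniqueness input and is a different
object; `HeisenbergGroundStateSymmetry` treats the antiferromagnetic Heisenberg model. For the bond count,
the tree has only upper bounds (`card_filter_fermionTorusGraph_adj_le`,
`card_filter_fermionTorusGraph_two_adj_le_four`, `degree_torusGraph_le`); the equality `= 4` for `L ≥ 3`
(`card_filter_fermionTorusGraph_adj`) is new. Mathlib: `Module.finrank`, `Matrix.unitaryGroup`,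
`SimpleGraph.circulantGraph`, `Pi.single_injective`, `CharP.cast_eq_zero_iff`.

## References

* E. H. Lieb, *Two theorems on the Hubbard model*, Phys. Rev. Lett. 62 (1989) 1201, Theorem 2
  (uniqueness of the half-filled ground state for `U > 0`, `|A| = |B|`). [LiebPRL1989]
* E. H. Lieb, M. Loss, R. J. McCann, *Uniform density theorem for the Hubbard model*,
  J. Math. Phys. 34 (1993) 891, p. 894 (a symmetry image of the ground state "is also a ground
  state. By uniqueness, this state must be" the ground state). [LiebLossMccann1993]
* O. Bratteli, D. W. Robinson, *Operator Algebras and Quantum Statistical Mechanics II*, §5.2.2,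
  Thm. 5.2.5 (unitary implementation `Γ(U) a(f) Γ(U)* = a(Uf)` of one-particle unitaries). [BratteliRobinsonII1997]
* G. Benfatto, A. Giuliani, V. Mastropietro, Ann. Henri Poincaré 7 (2006) 809, §2.1–2.2
  (the symmetries (1)–(4) of the Hubbard torus: spin exchange, translations, rotations, parity). [BenfattoGiulianiMastropietro2006]
* D. J. Scalapino, Phys. Rep. 250 (1995) 329, §2 (square-lattice point group `C₄ᵥ ≅ D₄`). [Scalapino1995]
* S. Friedli, Y. Velenik, *Statistical Mechanics of Lattice Systems* (CUP 2017), §3.1 (the torus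
  `(ℤ/Lℤ)^d`, each vertex has `2d` neighbours). [FriedliVelenik2017]
-/

namespace Literature.MathematicalPhysics.QuantumLattice

open Matrix Finset HubbardWave0 Literature.Probability.LatticeModels
open scoped ComplexOrder

/-! ### §1 A symmetry of `H` maps ground states to ground states -/

section General

variable {ι : Type*} [LinearOrder ι] [Fintype ι]

/-- **A symmetry maps ground states to ground states.** If `U_π H U_πᴴ = H` (`relabel π H = H`)
then `U_π ψ` is an `N`-particle ground state of `H` whenever `ψ` is: `U_π` preserves the particle
number, is injective, and commutes with `H`. Lieb–Loss–McCann's "it is also a ground state".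
[cite: LiebLossMccann1993, p. 894 (remark after the Theorem: "It is also a ground state")] -/
theorem IsGroundState.fockRelabel_mulVec (π : Equiv.Perm ι) {H : Matrix (Finset ι) (Finset ι) ℂ}
    (hH : relabel π H = H) {N : ℕ} {ψ : Fock ι} (hψ : IsGroundState H N ψ) :
    IsGroundState H N ((fockRelabel π).val *ᵥ ψ) := by
  obtain ⟨hN, hne, heig⟩ := hψ
  refine ⟨hN.fockRelabel_mulVec π, fun h0 => hne ?_, ?_⟩
  · exact fockRelabel_mulVec_injective π
      (show (fockRelabel π).val *ᵥ ψ = (fockRelabel π).val *ᵥ (0 : Fock ι) by rw [h0, mulVec_zero])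
  · rw [mulVec_mulVec, ← (fockRelabel_commute_of_relabel_eq π hH).eq, ← mulVec_mulVec, heig,
      mulVec_smul]

omit [LinearOrder ι] in
/-- `⟨cψ, X cψ⟩ = (c̄c) ⟨ψ, X ψ⟩`. [folklore] -/
private theorem expect_smul_vec (X : Matrix (Finset ι) (Finset ι) ℂ) (c : ℂ) (ψ : Fock ι) :
    expect X (c • ψ) = star c * c * expect X ψ := by
  unfold expect
  rw [star_smul, mulVec_smul, smul_dotProduct, dotProduct_smul, smul_smul, smul_eq_mul]

/-- If a symmetry `U_π` of `H` is inverted, `H` is invariant under `U_{π⁻¹}` too. [folklore] -/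
private theorem relabel_symm_eq_of_relabel_eq (π : Equiv.Perm ι) {H : Matrix (Finset ι) (Finset ι) ℂ}
    (hH : relabel π H = H) : relabel π.symm H = H := by
  conv_lhs => rw [← hH]
  exact relabel_symm_relabel π H

end General

/-! ### §2 The unique half-filled ground state: `U_π ψ = c ψ` and invariant expectations -/

section Graph

variable {Λ : Type*} [LinearOrder Λ] [Fintype Λ] {G : SimpleGraph Λ} [DecidableRel G.Adj]

/-- **The half-filled ground state carries a one-dimensional representation of the symmetry group
of `H`.** For `G` connected and bipartite with `|Aᶜ| = |A|`, `t ≠ 0`, `U > 0`, `ψ` a half-filled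
ground state and `π` an orbital permutation with `U_π H U_πᴴ = H`: `U_π ψ = c ψ` for a complex
number with `c̄ c = 1`. (Symmetry image is a ground state; Lieb uniqueness; `U_π` is unitary.)
[cite: LiebPRL1989, Theorem 2] [cite: LiebLossMccann1993, p. 894 (remark after the Theorem)] -/
theorem exists_fockRelabel_mulVec_eq_smul_of_groundState (hG : G.Connected) (A : Finset Λ)
    (hA : ∀ x y : Λ, G.Adj x y → (x ∈ A ↔ y ∉ A)) (hcard : Aᶜ.card = A.card)
    {t U : ℝ} (ht : t ≠ 0) (hU : 0 < U) (π : Equiv.Perm (Orb Λ))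
    (hπ : relabel π (hamiltonian G t U) = hamiltonian G t U) {ψ : Fock (Orb Λ)}
    (hψ : IsGroundState (hamiltonian G t U) (Fintype.card Λ) ψ) :
    ∃ c : ℂ, star c * c = 1 ∧ (fockRelabel π).val *ᵥ ψ = c • ψ := by
  obtain ⟨c, hc⟩ := LiebHalfFilled.groundState_unique hG A hA hcard ht hU hψ
    (hψ.fockRelabel_mulVec π hπ)
  refine ⟨c, ?_, hc⟩
  have hunit := star_fockRelabel_mulVec_dotProduct π ψ
  rw [hc, star_smul, smul_dotProduct, dotProduct_smul, smul_smul, smul_eq_mul] at hunit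
  have hne : star ψ ⬝ᵥ ψ ≠ 0 := fun h => hψ.2.1 (dotProduct_star_self_eq_zero.1 h)
  exact mul_right_cancel₀ hne (by rw [hunit, one_mul])

/-- **Expectation values in the half-filled ground state are invariant under every symmetry of
`H`**: `⟨ψ, (U_π A U_πᴴ) ψ⟩ = ⟨ψ, A ψ⟩` for every operator `A`, whenever `U_π H U_πᴴ = H`
(the character `c` of `U_π ψ = cψ` cancels: `|c| = 1`).
[cite: LiebPRL1989, Theorem 2] [cite: LiebLossMccann1993, p. 894 (remark after the Theorem)] -/
theorem expect_relabel_eq_of_groundState (hG : G.Connected) (A : Finset Λ)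
    (hA : ∀ x y : Λ, G.Adj x y → (x ∈ A ↔ y ∉ A)) (hcard : Aᶜ.card = A.card)
    {t U : ℝ} (ht : t ≠ 0) (hU : 0 < U) (π : Equiv.Perm (Orb Λ))
    (hπ : relabel π (hamiltonian G t U) = hamiltonian G t U) {ψ : Fock (Orb Λ)}
    (hψ : IsGroundState (hamiltonian G t U) (Fintype.card Λ) ψ)
    (X : Matrix (Finset (Orb Λ)) (Finset (Orb Λ)) ℂ) :
    expect (relabel π X) ψ = expect X ψ := by
  obtain ⟨c, hcc, hc⟩ := exists_fockRelabel_mulVec_eq_smul_of_groundState hG A hA hcard ht hU π hπ hψ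
  have h := expect_relabel_fockRelabel_mulVec π X ψ
  rw [hc, expect_smul_vec, hcc, one_mul] at h
  exact h

/-- The inverse form: `⟨ψ, (U_πᴴ A U_π) ψ⟩ = ⟨ψ, A ψ⟩`, i.e. `⟨U_π ψ, A U_π ψ⟩ = ⟨ψ, A ψ⟩`.
[cite: LiebPRL1989, Theorem 2] [cite: LiebLossMccann1993, p. 894 (remark after the Theorem)] -/
theorem expect_relabel_symm_eq_of_groundState (hG : G.Connected) (A : Finset Λ)
    (hA : ∀ x y : Λ, G.Adj x y → (x ∈ A ↔ y ∉ A)) (hcard : Aᶜ.card = A.card)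
    {t U : ℝ} (ht : t ≠ 0) (hU : 0 < U) (π : Equiv.Perm (Orb Λ))
    (hπ : relabel π (hamiltonian G t U) = hamiltonian G t U) {ψ : Fock (Orb Λ)}
    (hψ : IsGroundState (hamiltonian G t U) (Fintype.card Λ) ψ)
    (X : Matrix (Finset (Orb Λ)) (Finset (Orb Λ)) ℂ) :
    expect (relabel π.symm X) ψ = expect X ψ :=
  expect_relabel_eq_of_groundState hG A hA hcard ht hU π.symm (relabel_symm_eq_of_relabel_eq π hπ) hψ X

/-! #### Graph automorphisms -/

/-- **Graph automorphisms**: for a site bijection `g` preserving adjacency,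
`⟨ψ, (U_g A U_gᴴ) ψ⟩ = ⟨ψ, A ψ⟩` in the half-filled ground state.
[cite: LiebPRL1989, Theorem 2] [cite: BenfattoGiulianiMastropietro2006, §2.1–2.2 (lattice symmetries)] -/
theorem expect_relabel_mapEquiv_eq_of_groundState (hG : G.Connected) (A : Finset Λ)
    (hA : ∀ x y : Λ, G.Adj x y → (x ∈ A ↔ y ∉ A)) (hcard : Aᶜ.card = A.card)
    {t U : ℝ} (ht : t ≠ 0) (hU : 0 < U) (g : Λ ≃ Λ) (hg : ∀ x y, G.Adj (g x) (g y) ↔ G.Adj x y)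
    {ψ : Fock (Orb Λ)} (hψ : IsGroundState (hamiltonian G t U) (Fintype.card Λ) ψ)
    (X : Matrix (Finset (Orb Λ)) (Finset (Orb Λ)) ℂ) :
    expect (relabel (Orb.mapEquiv g) X) ψ = expect X ψ :=
  expect_relabel_eq_of_groundState hG A hA hcard ht hU _ (relabel_hamiltonian G G g hg t U) hψ X

/-- **The one-body density matrix is invariant under graph automorphisms**:
`⟨c†_{g x,σ} c_{g y,τ}⟩ = ⟨c†_{xσ} c_{yτ}⟩`.
[cite: LiebPRL1989, Theorem 2] [cite: BenfattoGiulianiMastropietro2006, §2.1–2.2 (lattice symmetries)] -/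
theorem expect_creation_mul_annihilation_mapEquiv_of_groundState (hG : G.Connected) (A : Finset Λ)
    (hA : ∀ x y : Λ, G.Adj x y → (x ∈ A ↔ y ∉ A)) (hcard : Aᶜ.card = A.card)
    {t U : ℝ} (ht : t ≠ 0) (hU : 0 < U) (g : Λ ≃ Λ) (hg : ∀ x y, G.Adj (g x) (g y) ↔ G.Adj x y)
    {ψ : Fock (Orb Λ)} (hψ : IsGroundState (hamiltonian G t U) (Fintype.card Λ) ψ)
    (x y : Λ) (σ τ : Fin 2) :
    expect (creation (orb (g x) σ) * annihilation (orb (g y) τ)) ψ =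
      expect (creation (orb x σ) * annihilation (orb y τ)) ψ := by
  rw [← expect_relabel_mapEquiv_eq_of_groundState hG A hA hcard ht hU g hg hψ
    (creation (orb x σ) * annihilation (orb y τ)), relabel_mul, relabel_creation,
    relabel_annihilation, Orb.mapEquiv_orb, Orb.mapEquiv_orb]

/-- **Density–density correlators are invariant under graph automorphisms**:
`⟨n_{g x,σ} n_{g y,τ}⟩ = ⟨n_{xσ} n_{yτ}⟩`.
[cite: LiebPRL1989, Theorem 2] [cite: BenfattoGiulianiMastropietro2006, §2.1–2.2 (lattice symmetries)] -/
theorem expect_numberOp_mul_numberOp_mapEquiv_of_groundState (hG : G.Connected) (A : Finset Λ)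
    (hA : ∀ x y : Λ, G.Adj x y → (x ∈ A ↔ y ∉ A)) (hcard : Aᶜ.card = A.card)
    {t U : ℝ} (ht : t ≠ 0) (hU : 0 < U) (g : Λ ≃ Λ) (hg : ∀ x y, G.Adj (g x) (g y) ↔ G.Adj x y)
    {ψ : Fock (Orb Λ)} (hψ : IsGroundState (hamiltonian G t U) (Fintype.card Λ) ψ)
    (x y : Λ) (σ τ : Fin 2) :
    expect (numberOp (g x) σ * numberOp (g y) τ) ψ = expect (numberOp x σ * numberOp y τ) ψ := by
  rw [← expect_relabel_mapEquiv_eq_of_groundState hG A hA hcard ht hU g hg hψ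
    (numberOp x σ * numberOp y τ), relabel_mul, relabel_mapEquiv_numberOp, relabel_mapEquiv_numberOp]

/-! #### Spin exchange -/

/-- **Spin exchange**: `⟨ψ, (U_s A U_sᴴ) ψ⟩ = ⟨ψ, A ψ⟩` for the exchange `(x,σ) ↦ (x,1-σ)` of
the two spin values. [cite: LiebPRL1989, Theorem 2]
[cite: BenfattoGiulianiMastropietro2006, §2.1 (symmetry (1), spin exchange)] -/
theorem expect_relabel_spinSwap_eq_of_groundState (hG : G.Connected) (A : Finset Λ)
    (hA : ∀ x y : Λ, G.Adj x y → (x ∈ A ↔ y ∉ A)) (hcard : Aᶜ.card = A.card)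
    {t U : ℝ} (ht : t ≠ 0) (hU : 0 < U)
    {ψ : Fock (Orb Λ)} (hψ : IsGroundState (hamiltonian G t U) (Fintype.card Λ) ψ)
    (X : Matrix (Finset (Orb Λ)) (Finset (Orb Λ)) ℂ) :
    expect (relabel (Orb.spinSwap : Orb Λ ≃ Orb Λ) X) ψ = expect X ψ := by
  refine expect_relabel_eq_of_groundState hG A hA hcard ht hU _ ?_ hψ X
  have h := relabel_spinSwap_hamiltonianWith G t U 0
  rwa [hamiltonianWith_zero] at h

/-- **The one-body density matrix does not depend on the spin labels up to exchange**:
`⟨c†_{x,s σ} c_{y,s τ}⟩ = ⟨c†_{xσ} c_{yτ}⟩` with `s` the swap of `0` and `1`; in particular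
`G_↓(x,y) = G_↑(x,y)`. [cite: LiebPRL1989, Theorem 2]
[cite: BenfattoGiulianiMastropietro2006, §2.1 (symmetry (1), spin exchange)] -/
theorem expect_creation_mul_annihilation_spinSwap_of_groundState (hG : G.Connected) (A : Finset Λ)
    (hA : ∀ x y : Λ, G.Adj x y → (x ∈ A ↔ y ∉ A)) (hcard : Aᶜ.card = A.card)
    {t U : ℝ} (ht : t ≠ 0) (hU : 0 < U)
    {ψ : Fock (Orb Λ)} (hψ : IsGroundState (hamiltonian G t U) (Fintype.card Λ) ψ)
    (x y : Λ) (σ τ : Fin 2) :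
    expect (creation (orb x (Equiv.swap (0 : Fin 2) 1 σ)) *
        annihilation (orb y (Equiv.swap (0 : Fin 2) 1 τ))) ψ =
      expect (creation (orb x σ) * annihilation (orb y τ)) ψ := by
  rw [← expect_relabel_spinSwap_eq_of_groundState hG A hA hcard ht hU hψ
    (creation (orb x σ) * annihilation (orb y τ)), relabel_mul, relabel_creation,
    relabel_annihilation, Orb.spinSwap_orb, Orb.spinSwap_orb]

/-- `G_↓(x,y) = G_↑(x,y)`: `⟨c†_{x1} c_{y1}⟩ = ⟨c†_{x0} c_{y0}⟩` in the half-filled ground state.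
[cite: LiebPRL1989, Theorem 2] [cite: BenfattoGiulianiMastropietro2006, §2.1 (symmetry (1), spin exchange)] -/
theorem expect_creation_mul_annihilation_down_eq_up_of_groundState (hG : G.Connected) (A : Finset Λ)
    (hA : ∀ x y : Λ, G.Adj x y → (x ∈ A ↔ y ∉ A)) (hcard : Aᶜ.card = A.card)
    {t U : ℝ} (ht : t ≠ 0) (hU : 0 < U)
    {ψ : Fock (Orb Λ)} (hψ : IsGroundState (hamiltonian G t U) (Fintype.card Λ) ψ) (x y : Λ) :
    expect (creation (orb x 1) * annihilation (orb y 1)) ψ =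
      expect (creation (orb x 0) * annihilation (orb y 0)) ψ := by
  have h := expect_creation_mul_annihilation_spinSwap_of_groundState hG A hA hcard ht hU hψ x y 0 0
  rwa [Equiv.swap_apply_left] at h

end Graph

/-! ### §3 The even square torus: translations, the point group, equal bond amplitudes -/

section Torus

variable {L : ℕ} [NeZero L]

omit [NeZero L] in
/-- `|(ℤ/Lℤ)²| = L²` for the fermion torus. [folklore] -/
private theorem card_fermionTorus_two' : Fintype.card (FermionTorus 2 L) = L ^ 2 := by
  simp only [FermionTorus, Fintype.card_lex, Fintype.card_fun, Fintype.card_fin]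

omit [NeZero L] in
/-- `toTorusSite` is additive (coordinate-wise `Fin L → ZMod L` respects addition). [folklore] -/
private theorem toTorusSite_add' {d : ℕ} (x v : FermionTorus d L) :
    FermionTorus.toTorusSite (x + v) = FermionTorus.toTorusSite x + FermionTorus.toTorusSite v := by
  funext i
  simp only [FermionTorus.toTorusSite_apply, Pi.add_apply]
  rw [show ofLex (x + v) i = ofLex x i + ofLex v i from rfl, Fin.val_add, ZMod.natCast_mod,
    Nat.cast_add]

/-- The torus translation by `toTorusSite v` acts on native orbitals as `(x,σ) ↦ (x+v,σ)`. [folklore] -/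
private theorem translate_toTorusSite_orb (v x : FermionTorus 2 L) (σ : Fin 2) :
    Orb.translate (FermionTorus.toTorusSite v) (orb x σ) = orb (x + v) σ := by
  conv_lhs => rw [← FermionTorus.ofTorusSite_toTorusSite x]
  rw [Orb.translate_orb, ← toTorusSite_add', FermionTorus.ofTorusSite_toTorusSite]

omit [NeZero L] in
/-- Lieb's hypotheses on the even square torus in the `Fintype.card` normalisation, packaged for
the covariance theorems of §2. [cite: LiebPRL1989, Theorem 2] -/
private theorem torus_groundState_card {t U : ℝ}
    {ψ : Fock (Orb (FermionTorus 2 L))}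
    (hψ : IsGroundState (hamiltonian (fermionTorusGraph 2 L) t U) (L ^ 2) ψ) :
    IsGroundState (hamiltonian (fermionTorusGraph 2 L) t U) (Fintype.card (FermionTorus 2 L)) ψ := by
  rwa [card_fermionTorus_two']

/-- **Every symmetry of the Hubbard torus Hamiltonian leaves the half-filled ground-state
expectations invariant** (`L` even, `t ≠ 0`, `U > 0`): `relabel π H = H` implies
`⟨ψ, (U_π A U_πᴴ) ψ⟩ = ⟨ψ, A ψ⟩`. [cite: LiebPRL1989, Theorem 2]
[cite: LiebLossMccann1993, p. 894 (remark after the Theorem)] -/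
theorem hubbardTorus_expect_relabel_eq (hL : Even L) {t U : ℝ} (ht : t ≠ 0) (hU : 0 < U)
    {ψ : Fock (Orb (FermionTorus 2 L))}
    (hψ : IsGroundState (hamiltonian (fermionTorusGraph 2 L) t U) (L ^ 2) ψ)
    (π : Equiv.Perm (Orb (FermionTorus 2 L)))
    (hπ : relabel π (hamiltonian (fermionTorusGraph 2 L) t U) = hamiltonian (fermionTorusGraph 2 L) t U)
    (X : Matrix (Finset (Orb (FermionTorus 2 L))) (Finset (Orb (FermionTorus 2 L))) ℂ) :
    expect (relabel π X) ψ = expect X ψ := by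
  obtain ⟨hG, hA, h2, -⟩ := LiebHalfFilled.hubbardTorus_lieb_hypotheses (L := L) hL
  exact expect_relabel_eq_of_groundState hG _ hA (LiebHalfFilled.compl_card_eq_card_of_two_mul h2)
    ht hU π hπ (torus_groundState_card hψ) X

/-- **Translation invariance of the half-filled ground-state expectations on the torus**:
`⟨ψ, (U_v A U_vᴴ) ψ⟩ = ⟨ψ, A ψ⟩` for every translation `v ∈ (ℤ/Lℤ)²`.
[cite: LiebPRL1989, Theorem 2] [cite: BenfattoGiulianiMastropietro2006, §2.2 (translation invariance)] -/
theorem hubbardTorus_expect_relabel_translate_eq (hL : Even L) {t U : ℝ} (ht : t ≠ 0) (hU : 0 < U)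
    {ψ : Fock (Orb (FermionTorus 2 L))}
    (hψ : IsGroundState (hamiltonian (fermionTorusGraph 2 L) t U) (L ^ 2) ψ) (v : TorusSite 2 L)
    (X : Matrix (Finset (Orb (FermionTorus 2 L))) (Finset (Orb (FermionTorus 2 L))) ℂ) :
    expect (relabel (Orb.translate v) X) ψ = expect X ψ :=
  hubbardTorus_expect_relabel_eq hL ht hU hψ _ (relabel_translate_hubbardTorus v t U) X

/-- **`D₄` invariance of the half-filled ground-state expectations on the square torus**:
`⟨ψ, (U_γ A U_γᴴ) ψ⟩ = ⟨ψ, A ψ⟩` for every `γ` in the point group.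
[cite: LiebPRL1989, Theorem 2] [cite: Scalapino1995, §2 (square-lattice point group)] -/
theorem hubbardTorus_expect_relabel_d4Perm_eq (hL : Even L) {t U : ℝ} (ht : t ≠ 0) (hU : 0 < U)
    {ψ : Fock (Orb (FermionTorus 2 L))}
    (hψ : IsGroundState (hamiltonian (fermionTorusGraph 2 L) t U) (L ^ 2) ψ) (γ : DihedralGroup 4)
    (X : Matrix (Finset (Orb (FermionTorus 2 L))) (Finset (Orb (FermionTorus 2 L))) ℂ) :
    expect (relabel (Orb.d4Perm γ) X) ψ = expect X ψ :=
  hubbardTorus_expect_relabel_eq hL ht hU hψ _ (relabel_d4Perm_hubbardTorus γ t U) X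

/-- **Spin-exchange invariance of the half-filled ground-state expectations on the torus.**
[cite: LiebPRL1989, Theorem 2] [cite: BenfattoGiulianiMastropietro2006, §2.1 (symmetry (1), spin exchange)] -/
theorem hubbardTorus_expect_relabel_spinSwap_eq (hL : Even L) {t U : ℝ} (ht : t ≠ 0) (hU : 0 < U)
    {ψ : Fock (Orb (FermionTorus 2 L))}
    (hψ : IsGroundState (hamiltonian (fermionTorusGraph 2 L) t U) (L ^ 2) ψ)
    (X : Matrix (Finset (Orb (FermionTorus 2 L))) (Finset (Orb (FermionTorus 2 L))) ℂ) :
    expect (relabel (Orb.spinSwap : Orb (FermionTorus 2 L) ≃ Orb (FermionTorus 2 L)) X) ψ =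
      expect X ψ := by
  refine hubbardTorus_expect_relabel_eq hL ht hU hψ _ ?_ X
  have h := relabel_spinSwap_hamiltonianWith (fermionTorusGraph 2 L) t U 0
  rwa [hamiltonianWith_zero] at h

/-- **The one-body density matrix of the half-filled torus ground state is translation invariant**:
`⟨c†_{x+v,σ} c_{y+v,τ}⟩ = ⟨c†_{xσ} c_{yτ}⟩` — it depends on the displacement `y - x` (and the spins)
only. [cite: LiebPRL1989, Theorem 2] [cite: BenfattoGiulianiMastropietro2006, §2.2 (translation invariance)] -/
theorem hubbardTorus_expect_creation_mul_annihilation_translate (hL : Even L) {t U : ℝ} (ht : t ≠ 0)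
    (hU : 0 < U) {ψ : Fock (Orb (FermionTorus 2 L))}
    (hψ : IsGroundState (hamiltonian (fermionTorusGraph 2 L) t U) (L ^ 2) ψ)
    (v x y : FermionTorus 2 L) (σ τ : Fin 2) :
    expect (creation (orb (x + v) σ) * annihilation (orb (y + v) τ)) ψ =
      expect (creation (orb x σ) * annihilation (orb y τ)) ψ := by
  rw [← hubbardTorus_expect_relabel_translate_eq hL ht hU hψ (FermionTorus.toTorusSite v)
    (creation (orb x σ) * annihilation (orb y τ)), relabel_mul, relabel_creation,
    relabel_annihilation, translate_toTorusSite_orb, translate_toTorusSite_orb]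

/-- **Density–density correlators of the half-filled torus ground state are translation
invariant**: `⟨n_{x+v,σ} n_{y+v,τ}⟩ = ⟨n_{xσ} n_{yτ}⟩`.
[cite: LiebPRL1989, Theorem 2] [cite: BenfattoGiulianiMastropietro2006, §2.2 (translation invariance)] -/
theorem hubbardTorus_expect_numberOp_mul_numberOp_translate (hL : Even L) {t U : ℝ} (ht : t ≠ 0)
    (hU : 0 < U) {ψ : Fock (Orb (FermionTorus 2 L))}
    (hψ : IsGroundState (hamiltonian (fermionTorusGraph 2 L) t U) (L ^ 2) ψ)
    (v x y : FermionTorus 2 L) (σ τ : Fin 2) :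
    expect (numberOp (x + v) σ * numberOp (y + v) τ) ψ = expect (numberOp x σ * numberOp y τ) ψ := by
  have h := hubbardTorus_expect_relabel_translate_eq hL ht hU hψ (FermionTorus.toTorusSite v)
    (numberOp x σ * numberOp y τ)
  rw [relabel_mul, numberOp, numberOp, relabel_mul, relabel_mul, relabel_creation,
    relabel_annihilation, relabel_creation, relabel_annihilation, translate_toTorusSite_orb,
    translate_toTorusSite_orb] at h
  exact h

/-- **Spin independence of the one-body density matrix on the torus**: `G_↓(x,y) = G_↑(x,y)`.
[cite: LiebPRL1989, Theorem 2] [cite: BenfattoGiulianiMastropietro2006, §2.1 (symmetry (1), spin exchange)] -/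
theorem hubbardTorus_expect_creation_mul_annihilation_down_eq_up (hL : Even L) {t U : ℝ}
    (ht : t ≠ 0) (hU : 0 < U) {ψ : Fock (Orb (FermionTorus 2 L))}
    (hψ : IsGroundState (hamiltonian (fermionTorusGraph 2 L) t U) (L ^ 2) ψ)
    (x y : FermionTorus 2 L) :
    expect (creation (orb x 1) * annihilation (orb y 1)) ψ =
      expect (creation (orb x 0) * annihilation (orb y 0)) ψ := by
  obtain ⟨hG, hA, h2, -⟩ := LiebHalfFilled.hubbardTorus_lieb_hypotheses (L := L) hL
  exact expect_creation_mul_annihilation_down_eq_up_of_groundState hG _ hA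
    (LiebHalfFilled.compl_card_eq_card_of_two_mul h2) ht hU (torus_groundState_card hψ) x y

/-! #### All nearest-neighbour bond amplitudes are equal -/

omit [NeZero L] in
/-- The rotation by `π/2` fixes the origin. [folklore] -/
private theorem rotSite_zero : rotSite (0 : TorusSite 2 L) = 0 := by
  funext k; fin_cases k <;> simp [rotSite]

omit [NeZero L] in
/-- `rot e₁ = e₂`. [folklore] -/
private theorem rotSite_single_zero : rotSite (Pi.single 0 1 : TorusSite 2 L) = Pi.single 1 1 := by
  funext k; fin_cases k <;> simp [rotSite]

omit [NeZero L] in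
/-- `rot e₂ = -e₁`. [folklore] -/
private theorem rotSite_single_one : rotSite (Pi.single 1 1 : TorusSite 2 L) = -Pi.single 0 1 := by
  funext k; fin_cases k <;> simp [rotSite]

omit [NeZero L] in
/-- `rot (-e₁) = -e₂`. [folklore] -/
private theorem rotSite_neg_single_zero :
    rotSite (-Pi.single 0 1 : TorusSite 2 L) = -Pi.single 1 1 := by
  funext k; fin_cases k <;> simp [rotSite]

omit [NeZero L] in
/-- The generator `r` of `D₄` acts on sites by `rotSite`. [folklore] -/
private theorem d4Site_r_one (x : TorusSite 2 L) : d4Site (DihedralGroup.r 1) x = rotSite x := rfl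

/-- Rotation step: `⟨c†_{0σ} c_{rot u,σ}⟩ = ⟨c†_{0σ} c_{uσ}⟩` in the half-filled torus ground state.
[cite: LiebPRL1989, Theorem 2] [cite: Scalapino1995, §2 (square-lattice point group)] -/
private theorem oneBody_origin_rotSite (hL : Even L) {t U : ℝ} (ht : t ≠ 0) (hU : 0 < U)
    {ψ : Fock (Orb (FermionTorus 2 L))}
    (hψ : IsGroundState (hamiltonian (fermionTorusGraph 2 L) t U) (L ^ 2) ψ)
    (u : TorusSite 2 L) (σ : Fin 2) :
    expect (creation (orb (FermionTorus.ofTorusSite (0 : TorusSite 2 L)) σ) *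
        annihilation (orb (FermionTorus.ofTorusSite (rotSite u)) σ)) ψ =
      expect (creation (orb (FermionTorus.ofTorusSite (0 : TorusSite 2 L)) σ) *
        annihilation (orb (FermionTorus.ofTorusSite u) σ)) ψ := by
  have h := hubbardTorus_expect_relabel_d4Perm_eq hL ht hU hψ (DihedralGroup.r 1)
    (creation (orb (FermionTorus.ofTorusSite (0 : TorusSite 2 L)) σ) *
      annihilation (orb (FermionTorus.ofTorusSite u) σ))
  rw [relabel_mul, relabel_d4Perm_creation, relabel_d4Perm_annihilation, d4Site_r_one,
    d4Site_r_one, rotSite_zero] at h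
  exact h

/-- Reduction of a bond amplitude to the reference bond `(0, e₁)` with spin `0`.
[cite: LiebPRL1989, Theorem 2] [cite: BenfattoGiulianiMastropietro2006, §2.1–2.2 (lattice symmetries)] -/
private theorem oneBody_nn_eq_ref (hL : Even L) {t U : ℝ} (ht : t ≠ 0) (hU : 0 < U)
    {ψ : Fock (Orb (FermionTorus 2 L))}
    (hψ : IsGroundState (hamiltonian (fermionTorusGraph 2 L) t U) (L ^ 2) ψ)
    {x y : FermionTorus 2 L} (hxy : (fermionTorusGraph 2 L).Adj x y) (σ : Fin 2) :
    expect (creation (orb x σ) * annihilation (orb y σ)) ψ =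
      expect (creation (orb (FermionTorus.ofTorusSite (0 : TorusSite 2 L)) 0) *
        annihilation (orb (FermionTorus.ofTorusSite (Pi.single 0 1)) 0)) ψ := by
  -- spin: reduce to `σ = 0`
  have hspin : expect (creation (orb x σ) * annihilation (orb y σ)) ψ =
      expect (creation (orb x 0) * annihilation (orb y 0)) ψ := by
    fin_cases σ
    · rfl
    · exact hubbardTorus_expect_creation_mul_annihilation_down_eq_up hL ht hU hψ x y
  rw [hspin]
  -- translation by `-x`: reduce to the origin
  set tx := FermionTorus.toTorusSite x with htx
  set ty := FermionTorus.toTorusSite y with hty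
  have htr := hubbardTorus_expect_relabel_translate_eq hL ht hU hψ (-tx)
    (creation (orb x 0) * annihilation (orb y 0))
  rw [relabel_mul, ← FermionTorus.ofTorusSite_toTorusSite x, ← FermionTorus.ofTorusSite_toTorusSite y,
    relabel_translate_creation, relabel_translate_annihilation, FermionTorus.ofTorusSite_toTorusSite,
    FermionTorus.ofTorusSite_toTorusSite, ← htx, ← hty, add_neg_cancel, ← sub_eq_add_neg] at htr
  rw [← htr]
  -- the displacement `ty - tx` is one of `±e₁, ±e₂`; rotate it to `e₁`
  have hrot := oneBody_origin_rotSite hL ht hU hψ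
  have hadj : (torusGraph 2 L).Adj tx ty := (fermionTorusGraph_adj x y).1 hxy
  rw [torusGraph_adj_iff] at hadj
  obtain ⟨-, ⟨i, hi⟩ | ⟨i, hi⟩⟩ := hadj
  · have hd : ty - tx = Pi.single i 1 := by rw [hi, add_sub_cancel_left]
    rw [hd]
    fin_cases i
    · rfl
    · -- `e₂ = rot e₁`
      have h1 := hrot (Pi.single 0 1) 0
      rw [rotSite_single_zero] at h1
      exact h1
  · have hd : ty - tx = -Pi.single i 1 := by rw [hi, sub_add_cancel_left]
    rw [hd]
    fin_cases i
    · -- `-e₁ = rot e₂ = rot (rot e₁)`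
      have h1 := hrot (Pi.single 0 1) 0
      have h2 := hrot (Pi.single 1 1) 0
      rw [rotSite_single_zero] at h1
      rw [rotSite_single_one] at h2
      exact h2.trans h1
    · -- `-e₂ = rot (-e₁)`
      have h1 := hrot (Pi.single 0 1) 0
      have h2 := hrot (Pi.single 1 1) 0
      have h3 := hrot (-Pi.single 0 1) 0
      rw [rotSite_single_zero] at h1
      rw [rotSite_single_one] at h2
      rw [rotSite_neg_single_zero] at h3
      exact h3.trans (h2.trans h1)

/-- **All nearest-neighbour hopping amplitudes of the half-filled torus ground state are equal**
(`L` even, `t ≠ 0`, `U > 0`): for any two ordered nearest-neighbour pairs `(x,y)`, `(x',y')` and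
any spins, `⟨c†_{xσ} c_{yσ}⟩ = ⟨c†_{x'σ'} c_{y'σ'}⟩` (translations, the rotation by `π/2` and spin
exchange act transitively on oriented bonds × spins, and each fixes the unique ground state up to a
phase). [cite: LiebPRL1989, Theorem 2]
[cite: BenfattoGiulianiMastropietro2006, §2.1–2.2 (lattice symmetries)] [cite: Scalapino1995, §2] -/
theorem hubbardTorus_expect_creation_mul_annihilation_nn_eq (hL : Even L) {t U : ℝ} (ht : t ≠ 0)
    (hU : 0 < U) {ψ : Fock (Orb (FermionTorus 2 L))}
    (hψ : IsGroundState (hamiltonian (fermionTorusGraph 2 L) t U) (L ^ 2) ψ)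
    {x y x' y' : FermionTorus 2 L} (hxy : (fermionTorusGraph 2 L).Adj x y)
    (hx'y' : (fermionTorusGraph 2 L).Adj x' y') (σ σ' : Fin 2) :
    expect (creation (orb x σ) * annihilation (orb y σ)) ψ =
      expect (creation (orb x' σ') * annihilation (orb y' σ')) ψ := by
  rw [oneBody_nn_eq_ref hL ht hU hψ hxy, oneBody_nn_eq_ref hL ht hU hψ hx'y']

/-- **The kinetic energy is the bond count times the common bond amplitude**: for every ordered
nearest-neighbour pair `(x₀, y₀)`, spin `σ₀` and hopping `t'`,
`⟨ψ, H(t',0) ψ⟩ = -t' · (Σ_x Σ_y Σ_σ [x ∼ y]) · ⟨c†_{x₀σ₀} c_{y₀σ₀}⟩`.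
[cite: LiebPRL1989, Theorem 2] [cite: BenfattoGiulianiMastropietro2006, §2.1–2.2 (lattice symmetries)] -/
theorem hubbardTorus_expect_hamiltonian_zero_eq_bondCount_mul (hL : Even L) {t U : ℝ} (ht : t ≠ 0)
    (hU : 0 < U) {ψ : Fock (Orb (FermionTorus 2 L))}
    (hψ : IsGroundState (hamiltonian (fermionTorusGraph 2 L) t U) (L ^ 2) ψ)
    {x₀ y₀ : FermionTorus 2 L} (h₀ : (fermionTorusGraph 2 L).Adj x₀ y₀) (σ₀ : Fin 2) (t' : ℝ) :
    expect (hamiltonian (fermionTorusGraph 2 L) t' 0) ψ =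
      -(t' : ℂ) * ((∑ x : FermionTorus 2 L, ∑ y : FermionTorus 2 L, ∑ _σ : Fin 2,
          if (fermionTorusGraph 2 L).Adj x y then (1 : ℂ) else 0) *
        expect (creation (orb x₀ σ₀) * annihilation (orb y₀ σ₀)) ψ) := by
  rw [expect_hamiltonian_zero_eq_sum (fermionTorusGraph 2 L) t' ψ, Finset.sum_mul]
  congr 1
  refine Finset.sum_congr rfl fun x _ => ?_
  rw [Finset.sum_mul]
  refine Finset.sum_congr rfl fun y _ => ?_
  rw [Finset.sum_mul]
  refine Finset.sum_congr rfl fun σ _ => ?_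
  split_ifs with hxy
  · rw [one_mul]
    exact hubbardTorus_expect_creation_mul_annihilation_nn_eq hL ht hU hψ hxy h₀ σ σ₀
  · rw [zero_mul]

/-! #### Counting the bonds of the torus -/

omit [NeZero L] in
/-- For `L ≥ 3`: `1 ≠ 0` and `1 + 1 ≠ 0` in `ℤ/Lℤ`. [folklore] -/
private theorem zmod_one_ne_zero_and_two_ne_zero (hL : 3 ≤ L) :
    (1 : ZMod L) ≠ 0 ∧ (1 : ZMod L) + 1 ≠ 0 := by
  refine ⟨?_, fun h => ?_⟩
  · haveI : Fact (1 < L) := ⟨by omega⟩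
    exact one_ne_zero
  · have h' : ((2 : ℕ) : ZMod L) = 0 := by
      rw [Nat.cast_ofNat, ← one_add_one_eq_two]
      exact h
    have hle := Nat.le_of_dvd two_pos ((CharP.cast_eq_zero_iff (ZMod L) L 2).1 h')
    omega

/-- `Fin 2 = {0, 1}`. [folklore] -/
private theorem fin_two_eq (s : Fin 2) : s = 0 ∨ s = 1 := by
  fin_cases s <;> simp

/-- **Each site of the square torus `(ℤ/Lℤ)²`, `L ≥ 3`, has exactly four neighbours**
(`x ± e₁`, `x ± e₂`, pairwise distinct because `1 ≠ 0` and `2 ≠ 0` in `ℤ/Lℤ`).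
[cite: FriedliVelenik2017, §3.1 (the torus; each vertex has 2d neighbours)] -/
theorem card_filter_fermionTorusGraph_adj (hL : 3 ≤ L) (x : FermionTorus 2 L) :
    (univ.filter fun y => (fermionTorusGraph 2 L).Adj x y).card = 4 := by
  classical
  obtain ⟨h1, h2⟩ := zmod_one_ne_zero_and_two_ne_zero (L := L) hL
  -- the signs `u 0 = 1`, `u 1 = -1`
  let u : Fin 2 → ZMod L := ![1, -1]
  have hu0 : u 0 = 1 := rfl
  have hu1 : u 1 = -1 := rfl
  have hu : ∀ s, u s ≠ 0 := by
    intro s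
    obtain rfl | rfl := fin_two_eq s
    · rw [hu0]; exact h1
    · rw [hu1]; exact neg_ne_zero.2 h1
  have hu' : ∀ s s', u s = u s' → s = s' := by
    intro s s' h
    obtain rfl | rfl := fin_two_eq s <;> obtain rfl | rfl := fin_two_eq s'
    · rfl
    · rw [hu0, hu1] at h
      exact absurd (eq_neg_iff_add_eq_zero.1 h) h2
    · rw [hu0, hu1] at h
      exact absurd (eq_neg_iff_add_eq_zero.1 h.symm) h2
    · rfl
  -- the four neighbours, indexed by (direction, sign)
  let f : Fin 2 × Fin 2 → FermionTorus 2 L := fun p =>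
    FermionTorus.ofTorusSite (x.toTorusSite + Pi.single p.1 (u p.2))
  have hf_apply : ∀ p : Fin 2 × Fin 2,
      (f p).toTorusSite = x.toTorusSite + Pi.single p.1 (u p.2) := fun p =>
    FermionTorus.toTorusSite_ofTorusSite _
  have hf : Function.Injective f := by
    rintro ⟨i, s⟩ ⟨i', s'⟩ h
    have h' : (Pi.single i (u s) : TorusSite 2 L) = Pi.single i' (u s') := by
      have hh := congrArg FermionTorus.toTorusSite h
      rw [hf_apply, hf_apply] at hh
      exact add_left_cancel hh
    have hi : i = i' := by
      by_contra hne
      have hii := congrFun h' i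
      rw [Pi.single_eq_same, Pi.single_eq_of_ne hne] at hii
      exact hu s hii
    subst hi
    have hs : u s = u s' := Pi.single_injective i h'
    rw [hu' s s' hs]
  have hset : (univ.filter fun y => (fermionTorusGraph 2 L).Adj x y) = univ.image f := by
    ext y
    simp only [Finset.mem_filter, Finset.mem_univ, true_and, Finset.mem_image]
    rw [fermionTorusGraph_adj, torusGraph_adj_iff]
    constructor
    · rintro ⟨-, ⟨i, hi⟩ | ⟨i, hi⟩⟩
      · refine ⟨(i, 0), ?_⟩
        show FermionTorus.ofTorusSite (x.toTorusSite + Pi.single i (u 0)) = y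
        rw [hu0, ← hi, FermionTorus.ofTorusSite_toTorusSite]
      · refine ⟨(i, 1), ?_⟩
        show FermionTorus.ofTorusSite (x.toTorusSite + Pi.single i (u 1)) = y
        rw [hu1, Pi.single_neg, hi, add_neg_cancel_right, FermionTorus.ofTorusSite_toTorusSite]
    · rintro ⟨⟨i, s⟩, rfl⟩
      rw [hf_apply]
      refine ⟨fun h => hu s ?_, ?_⟩
      · have hii := congrFun h i
        rw [Pi.add_apply, Pi.single_eq_same] at hii
        exact add_left_cancel (hii.symm.trans (add_zero _).symm)
      · obtain rfl | rfl := fin_two_eq s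
        · exact Or.inl ⟨i, by rw [hu0]⟩
        · refine Or.inr ⟨i, ?_⟩
          rw [hu1, Pi.single_neg, neg_add_cancel_right]
  rw [hset, Finset.card_image_of_injective _ hf, Finset.card_univ, Fintype.card_prod, Fintype.card_fin]

/-- **The square torus `(ℤ/Lℤ)²`, `L ≥ 3`, has `8L²` ordered (bond, spin) pairs**:
`Σ_x Σ_y Σ_σ [x ∼ y] = 8 L²`. [cite: FriedliVelenik2017, §3.1 (the torus; each vertex has 2d neighbours)] -/
theorem hubbardTorus_bondSpinCount (hL : 3 ≤ L) :
    (∑ x : FermionTorus 2 L, ∑ y : FermionTorus 2 L, ∑ _σ : Fin 2,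
        if (fermionTorusGraph 2 L).Adj x y then (1 : ℂ) else 0) = 8 * (L : ℂ) ^ 2 := by
  have hx : ∀ x : FermionTorus 2 L, (∑ y : FermionTorus 2 L, ∑ _σ : Fin 2,
      if (fermionTorusGraph 2 L).Adj x y then (1 : ℂ) else 0) = 8 := by
    intro x
    have h2 : ∀ y : FermionTorus 2 L,
        (∑ _σ : Fin 2, if (fermionTorusGraph 2 L).Adj x y then (1 : ℂ) else 0) =
          2 * (if (fermionTorusGraph 2 L).Adj x y then (1 : ℂ) else 0) := fun y => by
      rw [Finset.sum_const, Finset.card_univ, Fintype.card_fin, nsmul_eq_mul, Nat.cast_ofNat]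
    rw [Finset.sum_congr rfl fun y _ => h2 y, ← Finset.mul_sum, Finset.sum_boole,
      card_filter_fermionTorusGraph_adj hL x]
    norm_num
  rw [Finset.sum_congr rfl fun x _ => hx x, Finset.sum_const, Finset.card_univ,
    card_fermionTorus_two', nsmul_eq_mul]
  push_cast
  ring

/-- **Kinetic energy = `-8 t' L²` × the nearest-neighbour hopping amplitude** of the half-filled
torus ground state (`L ≥ 4` even, `t ≠ 0`, `U > 0`): for every ordered nearest-neighbour pair
`(x₀, y₀)` and spin `σ₀`, `⟨ψ, H(t',0) ψ⟩ = -t' · 8L² · ⟨ψ, c†_{x₀σ₀} c_{y₀σ₀} ψ⟩` — the quantity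
benchmark tables report as "the kinetic energy per bond".
[cite: LiebPRL1989, Theorem 2] [cite: BenfattoGiulianiMastropietro2006, §2.1–2.2 (lattice symmetries)] -/
theorem hubbardTorus_expect_hamiltonian_zero_eq_nn (hL : Even L) (hL3 : 3 ≤ L) {t U : ℝ}
    (ht : t ≠ 0) (hU : 0 < U) {ψ : Fock (Orb (FermionTorus 2 L))}
    (hψ : IsGroundState (hamiltonian (fermionTorusGraph 2 L) t U) (L ^ 2) ψ)
    {x₀ y₀ : FermionTorus 2 L} (h₀ : (fermionTorusGraph 2 L).Adj x₀ y₀) (σ₀ : Fin 2) (t' : ℝ) :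
    expect (hamiltonian (fermionTorusGraph 2 L) t' 0) ψ =
      -(t' : ℂ) * (8 * (L : ℂ) ^ 2) * expect (creation (orb x₀ σ₀) * annihilation (orb y₀ σ₀)) ψ := by
  rw [hubbardTorus_expect_hamiltonian_zero_eq_bondCount_mul hL ht hU hψ h₀ σ₀ t',
    hubbardTorus_bondSpinCount hL3]
  ring

end Torus

end Literature.MathematicalPhysics.QuantumLattice
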